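import Mathlib.Analysis.Normed.Operator.Basic
import Mathlib.Analysis.Normed.Operator.NNNorm
import HarnessLib

/-!
# Deviation-from-identity algebra for flow derivatives (K1L `stub_tailL` / `stub_oneLevelL`: uniform distortion of the coarse flows)

Helper file for crux K1L `LagrangianRenormalisationStep` (stmt-AnomalousDissipation-24912), plan `STUB-PLAN-tailL-K1L.md` rev 2 (evidence #32),
brick (iii): the interval induction `d_m(τ) ≤ d_{m−1}(τ)(1 + 3γ_m(τ)) + 3γ_m(τ)` for the distortion of the Lagrangian flows multiplies
near-identity derivatives `DX_{m−1}`, `DG`, `DY_m`, `DG⁻¹`.  Elementary operator-norm bookkeeping for continuous linear maps `T = id + A`: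
products (`norm_comp_sub_id_le`), two-sided inverses (`norm_inv_sub_id_le`: `‖T⁻¹ − id‖ ≤ δ/(1−δ)` for `‖T − id‖ ≤ δ < 1`, no Neumann series),
and conjugates (`norm_conj_sub_id_le`: `‖T (id + B) T⁻¹ − id‖ ≤ (1+δ)‖B‖/(1−δ)`).  No definitions, no named facts, no sorry.
Prover seat `ad-solenoidal-k2r-lowerlaw-p1` g5, 2026-08-28.
-/

set_option linter.dupNamespace false

namespace Summit.AnomalousDissipation.AnomalousDissipation.Theorems.SolenoidalFractalHomogenisation.LagrangianCarrier

variable {E : Type*} [NormedAddCommGroup E] [NormedSpace ℝ E]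

/-- **Products of near-identity maps**: `‖T₁ ∘ T₂ − id‖ ≤ ‖T₁ − id‖ + ‖T₂ − id‖ + ‖T₁ − id‖ ‖T₂ − id‖`. [folklore] -/
theorem norm_comp_sub_id_le (T₁ T₂ : E →L[ℝ] E) :
    ‖T₁.comp T₂ - ContinuousLinearMap.id ℝ E‖ ≤
      ‖T₁ - ContinuousLinearMap.id ℝ E‖ + ‖T₂ - ContinuousLinearMap.id ℝ E‖ +
        ‖T₁ - ContinuousLinearMap.id ℝ E‖ * ‖T₂ - ContinuousLinearMap.id ℝ E‖ := by
  set A := T₁ - ContinuousLinearMap.id ℝ E with hA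
  set B := T₂ - ContinuousLinearMap.id ℝ E with hB
  have e : T₁.comp T₂ - ContinuousLinearMap.id ℝ E = A + B + A.comp B := by
    have hT₁ : T₁ = A + ContinuousLinearMap.id ℝ E := by rw [hA]; abel
    have hT₂ : T₂ = B + ContinuousLinearMap.id ℝ E := by rw [hB]; abel
    rw [hT₁, hT₂, ContinuousLinearMap.add_comp, ContinuousLinearMap.comp_add, ContinuousLinearMap.id_comp,
      ContinuousLinearMap.comp_id]
    abel
  rw [e]
  calc ‖A + B + A.comp B‖ ≤ ‖A + B‖ + ‖A.comp B‖ := norm_add_le _ _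
    _ ≤ ‖A‖ + ‖B‖ + ‖A‖ * ‖B‖ := add_le_add (norm_add_le _ _) (ContinuousLinearMap.opNorm_comp_le _ _)

/-- The norm of a near-identity map: `‖T‖ ≤ 1 + ‖T − id‖`. [folklore] -/
theorem norm_le_one_add_norm_sub_id (T : E →L[ℝ] E) : ‖T‖ ≤ 1 + ‖T - ContinuousLinearMap.id ℝ E‖ := by
  calc ‖T‖ = ‖ContinuousLinearMap.id ℝ E + (T - ContinuousLinearMap.id ℝ E)‖ := by rw [add_sub_cancel]
    _ ≤ ‖ContinuousLinearMap.id ℝ E‖ + ‖T - ContinuousLinearMap.id ℝ E‖ := norm_add_le _ _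
    _ ≤ 1 + ‖T - ContinuousLinearMap.id ℝ E‖ := by
        have h := ContinuousLinearMap.norm_id_le (𝕜 := ℝ) (E := E)
        linarith

/-- **Two-sided inverses of near-identity maps are near the identity**: if `‖T − id‖ ≤ δ < 1` and `T' ∘ T = id` then
`‖T' − id‖ ≤ δ/(1 − δ)` (`T' − id = T'(id − T)`, so `x ≤ (1 + x)δ`). [folklore] -/
theorem norm_inv_sub_id_le {T T' : E →L[ℝ] E} {δ : ℝ} (hδ : ‖T - ContinuousLinearMap.id ℝ E‖ ≤ δ) (hδ1 : δ < 1)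
    (hinv : T'.comp T = ContinuousLinearMap.id ℝ E) :
    ‖T' - ContinuousLinearMap.id ℝ E‖ ≤ δ / (1 - δ) := by
  have hδ0 : 0 ≤ δ := (norm_nonneg _).trans hδ
  -- `T' − id = T' ∘ (id − T)`
  have e : T' - ContinuousLinearMap.id ℝ E = T'.comp (ContinuousLinearMap.id ℝ E - T) := by
    rw [ContinuousLinearMap.comp_sub, hinv, ContinuousLinearMap.comp_id]
  set x := ‖T' - ContinuousLinearMap.id ℝ E‖ with hx
  have h1 : x ≤ ‖T'‖ * δ := by
    rw [hx, e]
    refine (ContinuousLinearMap.opNorm_comp_le _ _).trans ?_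
    refine mul_le_mul_of_nonneg_left ?_ (norm_nonneg _)
    rwa [← norm_neg, neg_sub]
  have h2 : ‖T'‖ ≤ 1 + x := norm_le_one_add_norm_sub_id T'
  have h3 : x ≤ (1 + x) * δ := h1.trans (mul_le_mul_of_nonneg_right h2 hδ0)
  rw [le_div_iff₀ (by linarith)]
  nlinarith

/-- **Conjugates of near-identity maps**: if `T' ∘ T = id = T ∘ T'`, `‖T − id‖ ≤ δ < 1` and `‖C − id‖ ≤ β`, then
`‖T ∘ C ∘ T' − id‖ ≤ (1 + δ) β / (1 − δ)` (`T C T' − id = T (C − id) T'`). [folklore] -/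
theorem norm_conj_sub_id_le {T T' C : E →L[ℝ] E} {δ β : ℝ} (hδ : ‖T - ContinuousLinearMap.id ℝ E‖ ≤ δ) (hδ1 : δ < 1)
    (hβ : ‖C - ContinuousLinearMap.id ℝ E‖ ≤ β)
    (hinv : T'.comp T = ContinuousLinearMap.id ℝ E) (hinv' : T.comp T' = ContinuousLinearMap.id ℝ E) :
    ‖(T.comp C).comp T' - ContinuousLinearMap.id ℝ E‖ ≤ (1 + δ) * β / (1 - δ) := by
  have hδ0 : 0 ≤ δ := (norm_nonneg _).trans hδ
  have hβ0 : 0 ≤ β := (norm_nonneg _).trans hβ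
  have e : (T.comp C).comp T' - ContinuousLinearMap.id ℝ E = (T.comp (C - ContinuousLinearMap.id ℝ E)).comp T' := by
    rw [ContinuousLinearMap.comp_sub, ContinuousLinearMap.sub_comp, ContinuousLinearMap.comp_id, hinv']
  rw [e]
  have hT : ‖T‖ ≤ 1 + δ := (norm_le_one_add_norm_sub_id T).trans (by linarith)
  have hT' : ‖T'‖ ≤ 1 + δ / (1 - δ) :=
    (norm_le_one_add_norm_sub_id T').trans (by linarith [norm_inv_sub_id_le hδ hδ1 hinv])
  have h1δ : 0 < 1 - δ := by linarith
  have hT'' : ‖T'‖ ≤ 1 / (1 - δ) := by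
    have : 1 + δ / (1 - δ) = 1 / (1 - δ) := by field_simp; ring
    linarith
  calc ‖(T.comp (C - ContinuousLinearMap.id ℝ E)).comp T'‖ ≤ ‖T.comp (C - ContinuousLinearMap.id ℝ E)‖ * ‖T'‖ :=
        ContinuousLinearMap.opNorm_comp_le _ _
    _ ≤ (‖T‖ * ‖C - ContinuousLinearMap.id ℝ E‖) * ‖T'‖ :=
        mul_le_mul_of_nonneg_right (ContinuousLinearMap.opNorm_comp_le _ _) (norm_nonneg _)
    _ ≤ ((1 + δ) * β) * (1 / (1 - δ)) :=
        mul_le_mul (mul_le_mul hT hβ (norm_nonneg _) (by linarith)) hT'' (norm_nonneg _) (by positivity)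
    _ = (1 + δ) * β / (1 - δ) := by ring

/-- **One induction step of the distortion recursion** (plan rev 2, (c)): with `‖DX_{m−1} − id‖ ≤ d`, `‖DG − id‖ ≤ δ ≤ 1/2`, `‖DY − id‖ ≤ γ`
and `G⁻¹` a two-sided inverse, `‖DX_{m−1} ∘ (DG ∘ DY ∘ DG⁻¹) − id‖ ≤ d (1 + 3γ) + 3γ`. [cite: ArmstrongVicol2025, §5.1 (flow estimates on nested windows)] -/
theorem norm_flowStep_sub_id_le {X G G' Y : E →L[ℝ] E} {d δ γ : ℝ}
    (hX : ‖X - ContinuousLinearMap.id ℝ E‖ ≤ d) (hG : ‖G - ContinuousLinearMap.id ℝ E‖ ≤ δ) (hδ : δ ≤ 1 / 2)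
    (hY : ‖Y - ContinuousLinearMap.id ℝ E‖ ≤ γ)
    (hinv : G'.comp G = ContinuousLinearMap.id ℝ E) (hinv' : G.comp G' = ContinuousLinearMap.id ℝ E) :
    ‖X.comp ((G.comp Y).comp G') - ContinuousLinearMap.id ℝ E‖ ≤ d * (1 + 3 * γ) + 3 * γ := by
  have hd0 : 0 ≤ d := (norm_nonneg _).trans hX
  have hγ0 : 0 ≤ γ := (norm_nonneg _).trans hY
  have hδ0 : 0 ≤ δ := (norm_nonneg _).trans hG
  have hconj := norm_conj_sub_id_le hG (by linarith) hY hinv hinv'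
  have hconj' : ‖(G.comp Y).comp G' - ContinuousLinearMap.id ℝ E‖ ≤ 3 * γ := by
    refine hconj.trans ?_
    rw [div_le_iff₀ (by linarith)]
    nlinarith
  calc ‖X.comp ((G.comp Y).comp G') - ContinuousLinearMap.id ℝ E‖
      ≤ ‖X - ContinuousLinearMap.id ℝ E‖ + ‖(G.comp Y).comp G' - ContinuousLinearMap.id ℝ E‖ +
          ‖X - ContinuousLinearMap.id ℝ E‖ * ‖(G.comp Y).comp G' - ContinuousLinearMap.id ℝ E‖ := norm_comp_sub_id_le _ _
    _ ≤ d + 3 * γ + d * (3 * γ) := by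
        gcongr
    _ = d * (1 + 3 * γ) + 3 * γ := by ring

end Summit.AnomalousDissipation.AnomalousDissipation.Theorems.SolenoidalFractalHomogenisation.LagrangianCarrier
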